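import Mathlib.Algebra.Polynomial.Eval.Defs
import Literature.Computability.QuantumComplexity.ShallowCircuitsAncillas
import Literature.Computability.QuantumComplexity.ShallowCircuitsEncodeProofs
import Literature.Computability.Complexity.ConstantDepth
import HarnessLib

/-!
# Relation (search) problems for shallow circuits: `QNC⁰` without advice versus `FAC⁰[p]/rpoly`

The vocabulary in which Watts–Kothari–Schaeffer–Tal 2019 and Grewal–Kumar 2024 state their
separations and their open problem: a family of RELATION problems (WKST §1.1, footnote: "search
problems in `AC⁰` … formally `FAC⁰`"), solved by a constant-depth Clifford+`T` family with
polynomially many ancillas in `|0⟩` and NO advice state (`QNC0Solves`, the shape of the tree's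
`hlf_quantum_constant_depth`), versus hardness for tuples of `accBasis p` circuits with UNIFORM
shared random bits (`FACCHard`: some promised input on which the success probability over the
uniform random string is `≤ θ`; the shape of the tree's `hlf_classical_depth_lower_bound`). This
is the uniform-`ρ` special case of WKST §1.1's `AC⁰[p]/rpoly` ("the circuit gets to draw one
sample from [any] probability distribution on polynomially many bits"); taking `r = 0` it contains
plain (deterministic) `FAC⁰[p]`, so hardness in this sense implies the open statement of WKST §1.3,
but it is NOT literally `/rpoly`-hardness for arbitrary advice distributions (cell qa-qnc0 referee
erratum E1(b), REF-ROUND-3 §4; the `/rpoly` form follows from average-case hardness over uniform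
INPUTS by fixing the best advice string, as in the proof of WKST Theorem 15, and is not stated
here).

* `hlfFamily` — 2D HLF packaged as a `RelFamily`; `qnc0Solves_hlfFamily` — **Bravyi–Gosset–König
  Theorem 1 in class form**: 2D HLF is solved with certainty by advice-free `QNC⁰`
  (tree `hlf_quantum_constant_depth_ancillas`, `m ≤ N²` ancillas, depth `98`);
  `faccHard_hlfFamily` — the bookkeeping from hardness of 2D HLF in the instance form of
  `hlf_classical_depth_lower_bound` (with `accBasis p`) to `FACCHard p hlfFamily θ`.

The OPEN statements themselves ("some relation problem is in advice-free `QNC⁰` but hard for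
`FAC⁰[p]/rpoly`", WKST 2019 §1.3 / Grewal–Kumar 2024 §1.3; "2D HLF is hard for `FAC⁰[p]/rpoly`")
are NOT Literature facts; they live on the Summits side (cell qa-qnc0 / its route files) as
`∃ R, … QNC0Solves R 0 ∧ ∃ θ < 1, FACCHard p R θ` over this vocabulary. The typed statements
were fixed by planner seat qa-qnc0-p1 of cell qa-qnc0 (2026-08-25).

## References

* A. Bene Watts, R. Kothari, L. Schaeffer, A. Tal, *Exponential separation between shallow quantum
  circuits and unbounded fan-in shallow classical circuits*, STOC 2019, arXiv:1906.08890, §1.1,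
  §1.3 [WattsEtAl2019].
* S. Grewal, V. M. Kumar, *Improved circuit lower bounds and quantum-classical separations*,
  arXiv:2408.16406 (2024), §1.3, Def. 5.12 [GrewalKumar2024].
* S. Bravyi, D. Gosset, R. König, *Quantum advantage with shallow circuits*, Science 362 (2018)
  308–311, Theorem 1 [BravyiGossetKonigScience2018].
-/

noncomputable section

open Polynomial
open Literature.Computability.Cryptography Literature.Computability.Complexity

namespace Literature.Computability.QuantumComplexity

/-! ### Relation problems and the two solver notions -/

/-- A family of relation (search) problems: on index `n`, inputs of `inLen n` bits restricted to
the promise `dom n`, outputs of `outLen n` bits, validity predicate `valid n x y`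
(WKST 2019 §1.1: relation/search problems solved by circuit families).
[cite: WattsEtAl2019, §1.1] -/
structure RelFamily where
  /-- input length at index `n` -/
  inLen : ℕ → ℕ
  /-- output length at index `n` -/
  outLen : ℕ → ℕ
  /-- the promise -/
  dom : ∀ n, Set (Fin (inLen n) → Bool)
  /-- the relation -/
  valid : ∀ n, (Fin (inLen n) → Bool) → (Fin (outLen n) → Bool) → Prop

/-- `QNC⁰` solvability WITHOUT ADVICE, error `δ`: a constant `d` and a polynomial ancilla bound
`a` such that for every `n` some oracle-free Clifford+`T` circuit of depth `≤ d` on the input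
wires plus `m ≤ a(n)` ancillas initialised to `|0^m⟩` (what `QCircuit.outputPMF` provides — no
cat/GHZ resource state), with an injective choice of output wires, produces a valid output with
probability `≥ 1 - δ` on every promised input (WKST 2019 §1.1, "`QNC⁰` circuits"; the shape of
the tree's `hlf_quantum_constant_depth`). [cite: WattsEtAl2019, §1.1] -/
def QNC0Solves (R : RelFamily) (δ : ℝ) : Prop :=
  ∃ d : ℕ, ∃ a : Polynomial ℕ, ∀ n : ℕ,
    ∃ (m : ℕ) (C : QCircuit cliffordT (R.inLen n + m))
      (out : Fin (R.outLen n) → Fin (R.inLen n + m)),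
      m ≤ a.eval n ∧ Function.Injective out ∧ C.IsOracleFree ∧ C.depth ≤ d ∧
      ∀ x ∈ R.dom n,
        ENNReal.ofReal (1 - δ) ≤
          (C.outputPMF 0 x).toOuterMeasure {y | R.valid n x (fun i => y (out i))}

/-- Hardness for `FAC⁰[p]` with UNIFORM shared randomness, threshold `θ`: for every constant
depth `d` and polynomial size bound `s`, for all large `n`, every tuple of single-output circuits
over `accBasis p = {¬, ∧ₖ, ∨ₖ, MOD_{p,k}}` (one per output bit, `acDepth ≤ d`, size `≤ s n`,
reading the input followed by `r` shared uniform random bits) succeeds with probability `≤ θ` on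
SOME promised input — the uniform-`ρ` special case of WKST 2019 §1.1's `AC⁰[p]/rpoly` (arbitrary
advice distribution); `r = 0` covers deterministic `FAC⁰[p]` tuples, so `FACCHard` implies "not in
`FAC⁰[p]`" (WKST §1.3's open statement); the shape of the tree's
`hlf_classical_depth_lower_bound` with `accBasis p` / `acDepth`. [cite: WattsEtAl2019, §1.1] -/
def FACCHard (p : ℕ) (R : RelFamily) (θ : ℝ) : Prop :=
  ∀ d : ℕ, ∀ s : Polynomial ℕ, ∃ N₀ : ℕ, ∀ n ≥ N₀,
    ∀ (r : ℕ) (Cs : Fin (R.outLen n) → Circuit (Fin (R.inLen n + r))),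
      (∀ i, (Cs i).IsOver (accBasis p)) → (∀ i, (Cs i).acDepth ≤ d) →
      (∀ i, (Cs i).size ≤ s.eval n) →
      ∃ x ∈ R.dom n,
        uniformProb r
          {ρ | R.valid n x (fun i => (Cs i).eval (Fin.append x fun j => ρ.getD j false))} ≤ θ

/-! ### The candidate: 2D HLF -/

/-- **2D HLF as a relation family**: index `N` = grid side, inputs `encodeHLF I` of valid
instances (`inLen N` bits), outputs indexed by the `N²` grid vertices in row-major order, valid
iff the output lies in `hlfSolutions I` (BGK 2018 Theorem 1's problem; Grewal–Kumar Def. 5.12).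
[cite: GrewalKumar2024, Definition 5.12] -/
def hlfFamily : RelFamily where
  inLen := inLen
  outLen N := N * N
  dom N := {w | ∃ I : HLFInstance N, I.IsValid ∧ encodeHLF I = w}
  valid N w y := ∃ I : HLFInstance N, I.IsValid ∧ encodeHLF I = w ∧
    (fun v => y (finProdFinEquiv v)) ∈ hlfSolutions I

/-- The input length of 2D HLF is at most `3N²` (BGK Theorem 1: input size `Θ(N²)`).
[cite: BravyiGossetKonigScience2018, Theorem 1] -/
theorem hlfFamily_inLen_le (N : ℕ) : hlfFamily.inLen N ≤ (3 * X ^ 2 : Polynomial ℕ).eval N := by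
  simp only [hlfFamily, inLen, eval_mul, eval_ofNat, eval_pow, eval_X]
  have : N * (N - 1) ≤ N * N := Nat.mul_le_mul_left _ (Nat.sub_le _ _)
  nlinarith

/-- **Bravyi–Gosset–König Theorem 1 in class form**: advice-free `QNC⁰` circuits (depth `98`,
`N²` ancillas initialised to `|0⟩`) solve 2D HLF with certainty (tree
`hlf_quantum_constant_depth_ancillas`). [cite: BravyiGossetKonigScience2018, Theorem 1] -/
theorem qnc0Solves_hlfFamily : QNC0Solves hlfFamily 0 := by
  obtain ⟨d, hd⟩ := hlf_quantum_constant_depth_ancillas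
  refine ⟨d, X ^ 2, fun N => ?_⟩
  obtain ⟨m, C, out, hm, hinj, hof, hdepth, hsol⟩ := hd N
  refine ⟨m, C, fun i => out (finProdFinEquiv.symm i), ?_, ?_, hof, hdepth, ?_⟩
  · simpa [sq] using hm
  · exact hinj.comp finProdFinEquiv.symm.injective
  · rintro w ⟨I, hI, rfl⟩
    rw [sub_zero, ENNReal.ofReal_one, ← hsol I hI]
    refine MeasureTheory.measure_mono fun y hy => ?_
    refine ⟨I, hI, rfl, ?_⟩
    simpa only [Set.mem_setOf_eq, Equiv.symm_apply_apply] using hy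

/-- Monotonicity of `uniformProb`. [folklore] -/
private theorem uniformProb_mono' {m : ℕ} {E E' : Set (List Bool)} (h : E ⊆ E') :
    uniformProb m E ≤ uniformProb m E' := by
  classical
  unfold uniformProb
  refine div_le_div_of_nonneg_right ?_ (by positivity)
  exact_mod_cast Finset.card_le_card fun r hr => by
    simp only [Finset.mem_filter, Finset.mem_univ, true_and] at hr ⊢
    exact h hr

/-- **Classical half transfers**: hardness of 2D HLF for `FAC⁰[p]/rpoly` in the instance form
gives `FACCHard p hlfFamily θ` (the hard promised input is `encodeHLF I`; the encoding is
injective on valid instances, tree `encodeHLF_injective_holds`). [cite: WattsEtAl2019, §1.3] -/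
theorem faccHard_hlfFamily {p : ℕ} {θ : ℝ}
    (h : ∀ d : ℕ, ∀ s : Polynomial ℕ, ∃ N₀ : ℕ, ∀ N ≥ N₀,
      ∀ (r : ℕ) (Cs : Fin N × Fin N → Circuit (Fin (inLen N + r))),
        (∀ v, (Cs v).IsOver (accBasis p)) → (∀ v, (Cs v).acDepth ≤ d) →
        (∀ v, (Cs v).size ≤ s.eval N) →
        ∃ I : HLFInstance N, I.IsValid ∧
          uniformProb r
            {ρ | (fun v => (Cs v).eval (Fin.append (encodeHLF I) fun i => ρ.getD i false)) ∈
              hlfSolutions I} ≤ θ) :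
    FACCHard p hlfFamily θ := by
  intro d s
  obtain ⟨N₀, hN₀⟩ := h d s
  refine ⟨N₀, fun N hN r Cs hover hdep hsize => ?_⟩
  obtain ⟨I, hI, hprob⟩ := hN₀ N hN r (fun v => Cs (finProdFinEquiv v)) (fun v => hover _)
    (fun v => hdep _) (fun v => hsize _)
  refine ⟨encodeHLF I, ⟨I, hI, rfl⟩, (uniformProb_mono' ?_).trans hprob⟩
  rintro ρ ⟨I', hI', hII', hsol'⟩
  have hEq : I' = I := encodeHLF_injective_holds hI' hI hII'
  subst hEq
  exact hsol'

end Literature.Computability.QuantumComplexity
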